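import Summits.BirchSwinnertonDyer.BirchSwinnertonDyer.Theorems.SylvesterTwoHeegnerIndexCMFlipBottomKummer
import Literature.NumberTheory.EllipticCurves.HuShuYin2019.SylvesterTowerTwoTorsion
import Literature.NumberTheory.EllipticCurves.CubicTwistKolyvaginClassesJZero
import HarnessLib

/-!
# (S0) of leaf (L1) at `p ≡ 7 (mod 9)`, crux `UpperOffV0HSYPlus` (stmt-BirchSwinnertonDyer-19804): PREP for the
# HALVED system — half-sum bookkeeping, and NO `2`-TORSION in `ψ_B(E₉(K̄)^{N₀})` / in `E_p(K)` at the bottom level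

Skeleton of record VARIANT M (`Cruxes/UpperOffV0HSYPlus/Lines/coupled_variantM.lean` 406ca288e244d392), stub
`stub_layerL1Seven`; planner D507 (4); k7t-c2 g25 finding (STATUS 2026-08-28T23:40Z): at `p ≡ 7 (9)` the leaf needs
the classes of the HALVED derived points (HSY's `Y = 2Y′ + T′`), i.e. `χ`-sums over a HALF `H′` of
`H = Gal(K[9p]/K(∛3,∛p))`, `H = H′ ⊔ H′s` for an involution `s ∈ H` fixing the CM points (memo two §67.2 (W2-b),
an INPUT of the sequel files, not used here).  This file is input-free:

* §1 `sum_eq_two_nsmul_sum_of_mul_eq` — `Σ_{h ∈ G} f h = 2 • Σ_{h ∈ H′} f h` when `f (h s) = f h` and `H′` is a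
  half (`∀ h, Xor (h ∈ H′) (h s ∈ H′)`); `exists_half` — a half exists for `s ≠ 1`, `s² = 1`.
* §2 `apply_vB_eq_of_mem_fixer` (`N₀ = Gal(K̄/emb K[9p])` fixes `v_B`, `v_B³ = p/9`),
  `toGeomPoints_mem_map_fixedPoints` (`ι(E_p(K)) ⊆ ψ_B(E₉(K̄)^{N₀})`), `eq_zero_of_two_nsmul_eq_zero_of_mem`
  (no `2`-torsion in `ψ_B(E₉(K̄)^{N₀})`: `∛6 ∉ K[9p]`, k-ty1 `pow_three_ne_six_of_forall_apply_eq` +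
  `isAdmissible_map_fixedPoints_cubeSumCurve_nine`), `eq_zero_of_two_nsmul_eq_zero_rat` (`E_p(K)[2] = 0`).

Theorems only (no `def`, no `sorry`, no new `Prop`); nothing asserted on 19804; no stub closed; X12.CMAtTwo NOT
proved; BSD is not proved by any of this.  `--supports stmt-BirchSwinnertonDyer-19804 --as helper`.
-/

set_option linter.dupNamespace false
set_option autoImplicit false

noncomputable section

open scoped Classical Pointwise

namespace Summit.BirchSwinnertonDyer.BirchSwinnertonDyer.Theorems.SylvesterTwoCMHalf

open WeierstrassCurve WeierstrassCurve.Affine.Point Field NumberField IsDedekindDomain Finset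
open Literature.NumberTheory.EllipticCurves Literature.NumberTheory.GaloisRepresentations
  Literature.NumberTheory.EllipticCurves.ModularForms
  Literature.NumberTheory.EllipticCurves.HuShuYin2019
  Literature.NumberTheory.EllipticCurves.KolyvaginCocycle
  Summit.BirchSwinnertonDyer.BirchSwinnertonDyer.Theorems.SylvesterTwoCMData
  Summit.BirchSwinnertonDyer.BirchSwinnertonDyer.Theorems.SylvesterTwoCMFlip

variable {K : Type} [Field K] [NumberField K]

/-! ## §1. Halves of a finite group under right multiplication by a fixed element -/

/-- **Half-sum bookkeeping**: if right multiplication by `s` pairs the elements of a finite group `G` off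
against a subset `H′` (`∀ h, Xor (h ∈ H′) (h * s ∈ H′)`) and `f (h * s) = f h`, then
`Σ_{h} f h = 2 • Σ_{h ∈ H′} f h`.  [folklore] -/
theorem sum_eq_two_nsmul_sum_of_mul_eq {G : Type*} [Group G] [Fintype G] [DecidableEq G]
    {M : Type*} [AddCommMonoid M]
    (s : G) (H' : Finset G) (hH' : ∀ h : G, Xor (h ∈ H') (h * s ∈ H')) (f : G → M)
    (hf : ∀ h, f (h * s) = f h) : ∑ h, f h = 2 • ∑ h ∈ H', f h := by
  have hcompl : H'ᶜ = H'.map ⟨(· * s), mul_left_injective s⟩ := by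
    ext k
    simp only [Finset.mem_compl, Finset.mem_map, Function.Embedding.coeFn_mk]
    constructor
    · intro hk
      refine ⟨k * s⁻¹, ?_, by rw [inv_mul_cancel_right]⟩
      rcases hH' (k * s⁻¹) with ⟨h1, -⟩ | ⟨h2, -⟩
      · exact h1
      · rw [inv_mul_cancel_right] at h2; exact absurd h2 hk
    · rintro ⟨h, hh, rfl⟩
      rcases hH' h with ⟨-, h2⟩ | ⟨-, h1⟩
      · exact h2
      · exact absurd hh h1
  rw [← Finset.sum_add_sum_compl H' f, hcompl, Finset.sum_map, two_nsmul]
  simp only [Function.Embedding.coeFn_mk, hf]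

/-- **A half exists**: for `s ≠ 1` with `s * s = 1` in a finite group there is `H′` with
`∀ h, Xor (h ∈ H′) (h * s ∈ H′)` (one representative of each coset `{h, hs}` of `⟨s⟩`). [folklore] -/
theorem exists_half {G : Type*} [Group G] [Fintype G] [DecidableEq G] (s : G) (hs1 : s ≠ 1)
    (hs2 : s * s = 1) : ∃ H' : Finset G, ∀ h : G, Xor (h ∈ H') (h * s ∈ H') := by
  let S : Subgroup G := Subgroup.zpowers s
  let H' : Finset G := Finset.univ.image fun q : G ⧸ S ↦ Quotient.out q
  have hord : orderOf s = 2 := by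
    haveI : Fact (Nat.Prime 2) := ⟨Nat.prime_two⟩
    exact orderOf_eq_prime (by rw [pow_two, hs2]) hs1
  have hmemS : ∀ g : G, g ∈ S → g = 1 ∨ g = s := by
    intro g hg
    obtain ⟨k, rfl⟩ := Subgroup.mem_zpowers_iff.mp hg
    rw [← zpow_mod_orderOf, hord]
    rcases Int.emod_two_eq_zero_or_one k with h0 | h1
    · left; rw [show ((2 : ℕ) : ℤ) = 2 from rfl, h0, zpow_zero]
    · right; rw [show ((2 : ℕ) : ℤ) = 2 from rfl, h1, zpow_one]
  have hout : ∀ g : G, Quotient.out (QuotientGroup.mk g : G ⧸ S) = g ∨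
      Quotient.out (QuotientGroup.mk g : G ⧸ S) = g * s := by
    intro g
    obtain ⟨z, hz⟩ := QuotientGroup.mk_out_eq_mul S g
    rcases hmemS z z.2 with h1 | h2
    · left; rw [hz, h1, mul_one]
    · right; rw [hz, h2]
  have hmem : ∀ g : G, g ∈ H' ↔ Quotient.out (QuotientGroup.mk g : G ⧸ S) = g := by
    intro g
    simp only [H', Finset.mem_image, Finset.mem_univ, true_and]
    constructor
    · rintro ⟨q, hq⟩
      have : q = (QuotientGroup.mk g : G ⧸ S) := by rw [← hq]; exact (QuotientGroup.out_eq' q).symm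
      rw [← this, hq]
    · intro h; exact ⟨_, h⟩
  refine ⟨H', fun h ↦ ?_⟩
  have hmk : (QuotientGroup.mk (h * s) : G ⧸ S) = QuotientGroup.mk h := by
    rw [QuotientGroup.eq, mul_inv_rev, mul_assoc, inv_mul_cancel, mul_one]
    exact S.inv_mem (Subgroup.mem_zpowers s)
  rw [hmem, hmem, hmk]
  have hne : h * s ≠ h := by
    intro e; apply hs1
    have := congrArg (h⁻¹ * ·) e
    simpa using this
  rcases hout h with h1 | h2
  · rw [h1]; exact Or.inl ⟨rfl, fun e ↦ hne e.symm⟩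
  · rw [h2]; exact Or.inr ⟨rfl, hne⟩

/-! ## §2. No `2`-torsion in `ψ_B(E₉(K̄)^{N₀})` at the bottom level `K[9p]` (`∛6 ∉ K[9p]`, k-ty1) -/

/-- **`N₀ = Gal(K̄/emb K[9p])` fixes the cube root `v_B` of `p/9`** (`v_B³ = (∛p/∛3²)³` with `∛3, ∛p ∈ K[9p]`,
and `μ₃ ⊂ K`). [cite: HuShuYin2019, §2 Prop. 2.4 (1)] -/
theorem apply_vB_eq_of_mem_fixer {ω : K} (hω : ω ^ 2 + ω + 1 = 0) (ι : K →+* ℂ) {p : ℕ} (hp0 : p ≠ 0)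
    {vB : AlgebraicClosure K} (hvBc : vB ^ 3 = algebraMap ℚ (AlgebraicClosure K) ((p : ℚ) / 9))
    (emb : ringClassField K ι (9 * p) →+* AlgebraicClosure K)
    (N₀ : Subgroup (absoluteGaloisGroup K))
    (hN₀ : ∀ g : absoluteGaloisGroup K, g ∈ N₀ ↔
      ∀ x : ringClassField K ι (9 * p), (show AlgebraicClosure K ≃ₐ[K] AlgebraicClosure K from g) (emb x) = emb x)
    {c₃ cp : ringClassField K ι (9 * p)} (hc₃ : c₃ ^ 3 = 3) (hcp : cp ^ 3 = (p : ringClassField K ι (9 * p))) :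
    ∀ n ∈ N₀, (show AlgebraicClosure K ≃ₐ[K] AlgebraicClosure K from n) vB = vB := by
  have hc₃0 : c₃ ≠ 0 := fun h ↦ by rw [h] at hc₃; norm_num at hc₃
  have hcp0 : cp ≠ 0 := fun h ↦ by
    rw [h, zero_pow three_ne_zero] at hcp; exact hp0 (by exact_mod_cast hcp.symm)
  have hw3 : (emb cp / emb c₃ ^ 2) ^ 3 = vB ^ 3 := by
    rw [hvBc, div_pow, ← pow_mul, ← map_pow, ← map_pow, hcp, show 2 * 3 = 3 * 2 from rfl, pow_mul, hc₃,
      map_natCast, map_pow, map_ofNat, eq_ratCast]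
    push_cast; ring
  have hw0 : emb cp / emb c₃ ^ 2 ≠ 0 :=
    div_ne_zero ((map_ne_zero emb).mpr hcp0) (pow_ne_zero 2 ((map_ne_zero emb).mpr hc₃0))
  intro n hn
  exact JZero.apply_eq_self_of_cubeRoot hω _ hw0 hw3.symm
    (by rw [map_div₀, map_pow, (hN₀ n).mp hn c₃, (hN₀ n).mp hn cp])

/-- **`ι(E_p(K)) ⊆ ψ_B(E₉(K̄)^{N₀})`**: a `K`-rational point of `E_p`, read in `E_p(K̄)`, is the twist of an
`N₀`-fixed point of `E₉` (whenever `N₀` fixes `v_B`). [cite: HuShuYin2019, §3 p. 8] [cite: GrossLMS1991, §4 (4.2)] -/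
theorem toGeomPoints_mem_map_fixedPoints {p : ℕ} {vB : AlgebraicClosure K}
    {ψB : geomPoints ((cubeSumCurve 9).baseChange K) ≃+ geomPoints ((cubeSumCurve (p : ℚ)).baseChange K)}
    (hψB : ∀ {x y : AlgebraicClosure K}
      (h : (((cubeSumCurve 9).baseChange K).baseChange (AlgebraicClosure K)).toAffine.Nonsingular x y),
      ∃ h', ψB (Affine.Point.some x y h) = Affine.Point.some (vB ^ 2 * x) (vB ^ 3 * y) h')
    (N₀ : Subgroup (absoluteGaloisGroup K))
    (hNv : ∀ n ∈ N₀, (show AlgebraicClosure K ≃ₐ[K] AlgebraicClosure K from n) vB = vB)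
    (Z : ((cubeSumCurve (p : ℚ)).baseChange K).toAffine.Point) :
    toGeomPoints ((cubeSumCurve (p : ℚ)).baseChange K) Z ∈
      (FixedPoints.addSubgroup N₀ (geomPoints ((cubeSumCurve 9).baseChange K))).map ψB.toAddMonoidHom := by
  refine AddSubgroup.mem_map.mpr ⟨ψB.symm (toGeomPoints ((cubeSumCurve (p : ℚ)).baseChange K) Z), ?_, by simp⟩
  rw [JZero.mem_fixedPoints_iff]
  intro n hn
  apply ψB.injective
  rw [JZero.cubicTwist_smul_of_fix hψB (hNv n hn), ψB.apply_symm_apply, smul_toGeomPoints]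

/-- **No `2`-torsion in `ψ_B(E₉(K̄)^{N₀})`** for `N₀` the fixer of the embedded `K[9p]`: `E₉[2]` is rational over
`K(∛6)` only, and `∛6 ∉ K[9p]` (`K(∛6)/K` ramifies above `2`, `K[9p]/K` does not — k-ty1
`pow_three_ne_six_of_forall_apply_eq` + `isAdmissible_map_fixedPoints_cubeSumCurve_nine`).
[cite: GrossLMS1991, §4 Lemma 4.3] [cite: Cox2013, §9.A] -/
theorem eq_zero_of_two_nsmul_eq_zero_of_mem {ω : K} (hω : ω ^ 2 + ω + 1 = 0) (h2 : Module.finrank ℚ K = 2)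
    (ι : K →+* ℂ) {p : ℕ} (hp2 : Odd p)
    {vB : AlgebraicClosure K} (hvB : vB ≠ 0)
    (hvB3 : ∀ g : absoluteGaloisGroup K,
      ((show AlgebraicClosure K ≃ₐ[K] AlgebraicClosure K from g) vB) ^ 3 = vB ^ 3)
    {ψB : geomPoints ((cubeSumCurve 9).baseChange K) ≃+ geomPoints ((cubeSumCurve (p : ℚ)).baseChange K)}
    {ρ : absoluteGaloisGroup K →
      geomPoints ((cubeSumCurve 9).baseChange K) ≃+ geomPoints ((cubeSumCurve 9).baseChange K)}
    (hρ : ∀ (g : absoluteGaloisGroup K) {x y : AlgebraicClosure K}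
        (h : (((cubeSumCurve 9).baseChange K).baseChange (AlgebraicClosure K)).toAffine.Nonsingular x y),
        ∃ h', ρ g (Affine.Point.some x y h) =
          Affine.Point.some (((show AlgebraicClosure K ≃ₐ[K] AlgebraicClosure K from g) vB / vB) ^ 2 * x)
            y h')
    (hlawB : ∀ (g : absoluteGaloisGroup K) (P : geomPoints ((cubeSumCurve 9).baseChange K)),
        g • ψB P = ψB (ρ g (g • P)))
    (emb : ringClassField K ι (9 * p) →+* AlgebraicClosure K)
    (hemb : ∀ k : K, emb (algebraMap K (ringClassField K ι (9 * p)) k) = algebraMap K (AlgebraicClosure K) k)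
    (N₀ : Subgroup (absoluteGaloisGroup K))
    (hN₀ : ∀ g : absoluteGaloisGroup K, g ∈ N₀ ↔
      ∀ x : ringClassField K ι (9 * p), (show AlgebraicClosure K ≃ₐ[K] AlgebraicClosure K from g) (emb x) = emb x)
    {D : geomPoints ((cubeSumCurve (p : ℚ)).baseChange K)}
    (hD : D ∈ (FixedPoints.addSubgroup N₀ (geomPoints ((cubeSumCurve 9).baseChange K))).map ψB.toAddMonoidHom)
    (h2D : (2 : ℕ) • D = 0) : D = 0 := by
  have hK := JZero.isImaginaryQuadratic_of_sq_add_self_add_one hω h2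
  have hdK := JZero.discr_eq_neg_three_of_sq_add_self_add_one hω h2
  have hm0 : 9 * p ≠ 0 := mul_ne_zero (by norm_num) (by rintro rfl; exact (Nat.not_odd_zero hp2).elim)
  haveI := (finiteDimensional_and_isGalois_ringClassField hK ι hm0).2
  haveI hN₀n : N₀.Normal := normal_of_mem_iff emb hemb N₀ hN₀
  have h6 := pow_three_ne_six_of_forall_apply_eq hK ι (by rw [hdK]; decide)
    ((show Odd 9 by decide).mul hp2) emb hemb N₀ hN₀
  have hA₂ := isAdmissible_map_fixedPoints_cubeSumCurve_nine K hω hvB hvB3 hρ hlawB N₀ h6 1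
  exact hA₂.eq_zero_of_zsmul hD (by rw [pow_one, natCast_zsmul]; exact h2D)

/-- **`E_p(K)` has no `2`-torsion** (read through the frame: `ι(E_p(K)) ⊆ ψ_B(E₉(K̄)^{N₀})`).
[cite: HuShuYin2019, §3 p. 8] [cite: GrossLMS1991, §4 Lemma 4.3] -/
theorem eq_zero_of_two_nsmul_eq_zero_rat {ω : K} (hω : ω ^ 2 + ω + 1 = 0) (h2 : Module.finrank ℚ K = 2)
    (ι : K →+* ℂ) {p : ℕ} (hp0 : p ≠ 0) (hp2 : Odd p)
    {vB : AlgebraicClosure K} (hvBc : vB ^ 3 = algebraMap ℚ (AlgebraicClosure K) ((p : ℚ) / 9)) (hvB : vB ≠ 0)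
    (hvB3 : ∀ g : absoluteGaloisGroup K,
      ((show AlgebraicClosure K ≃ₐ[K] AlgebraicClosure K from g) vB) ^ 3 = vB ^ 3)
    {ψB : geomPoints ((cubeSumCurve 9).baseChange K) ≃+ geomPoints ((cubeSumCurve (p : ℚ)).baseChange K)}
    (hψB : ∀ {x y : AlgebraicClosure K}
      (h : (((cubeSumCurve 9).baseChange K).baseChange (AlgebraicClosure K)).toAffine.Nonsingular x y),
      ∃ h', ψB (Affine.Point.some x y h) = Affine.Point.some (vB ^ 2 * x) (vB ^ 3 * y) h')
    {ρ : absoluteGaloisGroup K →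
      geomPoints ((cubeSumCurve 9).baseChange K) ≃+ geomPoints ((cubeSumCurve 9).baseChange K)}
    (hρ : ∀ (g : absoluteGaloisGroup K) {x y : AlgebraicClosure K}
        (h : (((cubeSumCurve 9).baseChange K).baseChange (AlgebraicClosure K)).toAffine.Nonsingular x y),
        ∃ h', ρ g (Affine.Point.some x y h) =
          Affine.Point.some (((show AlgebraicClosure K ≃ₐ[K] AlgebraicClosure K from g) vB / vB) ^ 2 * x)
            y h')
    (hlawB : ∀ (g : absoluteGaloisGroup K) (P : geomPoints ((cubeSumCurve 9).baseChange K)),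
        g • ψB P = ψB (ρ g (g • P)))
    (emb : ringClassField K ι (9 * p) →+* AlgebraicClosure K)
    (hemb : ∀ k : K, emb (algebraMap K (ringClassField K ι (9 * p)) k) = algebraMap K (AlgebraicClosure K) k)
    (N₀ : Subgroup (absoluteGaloisGroup K))
    (hN₀ : ∀ g : absoluteGaloisGroup K, g ∈ N₀ ↔
      ∀ x : ringClassField K ι (9 * p), (show AlgebraicClosure K ≃ₐ[K] AlgebraicClosure K from g) (emb x) = emb x)
    {c₃ cp : ringClassField K ι (9 * p)} (hc₃ : c₃ ^ 3 = 3) (hcp : cp ^ 3 = (p : ringClassField K ι (9 * p)))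
    (Z : ((cubeSumCurve (p : ℚ)).baseChange K).toAffine.Point) (hZ : (2 : ℕ) • Z = 0) : Z = 0 := by
  apply toGeomPoints_injective ((cubeSumCurve (p : ℚ)).baseChange K)
  rw [_root_.map_zero]
  exact eq_zero_of_two_nsmul_eq_zero_of_mem hω h2 ι hp2 hvB hvB3 hρ hlawB emb hemb N₀ hN₀
    (toGeomPoints_mem_map_fixedPoints hψB N₀ (apply_vB_eq_of_mem_fixer hω ι hp0 hvBc emb N₀ hN₀ hc₃ hcp) Z)
    (by rw [← map_nsmul, hZ, _root_.map_zero])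

end Summit.BirchSwinnertonDyer.BirchSwinnertonDyer.Theorems.SylvesterTwoCMHalf

end
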